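import Literature.MathematicalPhysics.QuantumFieldTheory.Balaban1983to89.B8TowerBondsLevelSep
import Literature.MathematicalPhysics.QuantumFieldTheory.Balaban1983to89.B8IdxB8LawsCoverZero
import Literature.MathematicalPhysics.QuantumFieldTheory.Balaban1983to89.B8Eq191FlatLettersCubeMember
import Literature.MathematicalPhysics.QuantumFieldTheory.Balaban1983to89.B8CubeMemberIdxB8Laws

/-!
# `Balaban1983to89.B8TowerBondsLayerLawOfLam` — [Balaban1985RegularSpaces] (1.5) ⇒ THE LAYER LAW (L2) of `B8TowerBondsLevelSep`:
# «for `j < m` the `j`-block of a tower top of `Λs m j` avoids `Ω_{j+1}`» DERIVED from print's (1.5) «Λ_j = Ω_j^{(j)} ∖ Ω_{j+1}^{(j)}» AS TYPED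
# (`B8ConstraintBonds.Lam`), the admissibility record's saturation «Ω_j = Bʲ(Ω_j^{(j)})» (`DomainSeq.sat`) and the truncation law №8 (`trunc_lt`)

statement-level skeleton of published theorems with citation tags; proofs where landed; nothing here is a claim about the Yang–Mills mass gap

T. Bałaban, *Spaces of regular gauge field configurations on a lattice and gauge fixing conditions*, Commun. Math. Phys. **99** (1985) 75–102
`[Balaban1985RegularSpaces]` ("B8"; journal page = PDF page + 74): (1.3)–(1.6) p. 77 («Ω₀ ⊃ Ω₁ ⊃ … ⊃ Ω_k», «Ω_j = Bʲ(Ω_j^{(j)}), Ω_j is a sum of cubes …»,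
«Λ_j = Ω_j^{(j)} ∖ Ω_{j+1}^{(j)}, j = 0, 1, …, k − 1, Λ_k = Ω_k^{(k)}», «Ω = ⋃_j Bʲ(Λ_j)»), (1.19) p. 79 ∕ (1.34) p. 82 (truncated towers), (1.31) p. 82,
(1.68) p. 88, (1.131) p. 99, p. 98.  T. Bałaban, *Propagators and renormalization transformations for lattice gauge theories. II*, Commun. Math. Phys. **96**
(1984) 223–250 `[Balaban1984PropagatorsII]` ("B6"), (2.1)–(2.3) p. 224.  T. Bałaban, *Propagators for lattice gauge theories in a background field*, Commun.
Math. Phys. **99** (1985) 389–434 `[Balaban1985BackgroundPropagators]` ([4]), (3.16) p. 393.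

## WHY THIS FILE (cell `pub-ymgap`, HUMAN RULING D-0062 ∕ D-0149; DAG node N05 = [B8] (edge N06 → N05); width seat `pub-ymgap-dag-n05-w6` g2; proof lane,
## count-neutral; `--supports stmt-QuantumFields-20542`)

dag-n05-w2 g2's `B8TowerBondsLevelSep` (p599713) types the averaging-binder class law `LevelSepPP L m Ω (fun m' j => towerBondsP L Ω (Λs m') j) 1` at
print's class of a general Λ-tower from TWO displayed index laws, (L1) the unit collar and (L2) the layer law, and its §4 derives (L1) from the tree's typed
admissibility record `B8ConstraintBonds.DomainSeq` — leaving (L2) «for `j < m`, every site of the `j`-block of a point of `Λs m j` lies outside `Ω_{j+1}`»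
(`hlay`) as the ONE displayed geometric hypothesis of `levelSepPP_towerBondsP_of_domainSeq` and of the binder faces `avgAtP_withQQP_towerBondsP_trunc` ∕
`avgAtγ_withQQP_towerBondsP_trunc` (that seat's HANDOFF, «Located, NOT taken: (α) layer law from `B8ConstraintBonds.Lam` + `DomainSeq.sat` + `trunc_lt`»).
THIS FILE derives (L2) from print's own (1.5), in the vocabulary the tree already has:
* print's (1.5) is TYPED as `B8ConstraintBonds.Lam L Ω j = {x | IsLevel L j x ∧ x ∈ Ω j ∧ x ∉ Ω (j+1)}` (fine points of `ℤᵈ`); a family of tower tops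
  `Λ : ℕ → Set (Site d)` in the rescaled level coordinates of the B7∕B8 lineage READS it when «`z ∈ Λ j → Lʲ•z ∈ Lam L Ω j`» (r05's dictionary of
  `B8Eq131DomainSeq` §3, stated — never defined — exactly so; here only the `→` direction is needed, and of it only the clause `Lʲ•z ∉ Ω_{j+1}`);
* the record's saturation `DomainSeq.sat` («Ω_{j+1} = B^{j+1}(Ω_{j+1}^{(j+1)})»): a `j`-block is part of a `(j+1)`-block, so if ONE of its sites lies in `Ω_{j+1}`
  then so does its corner `Lʲ•z` — contradiction (§1, `not_mem_succ_of_under`);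
* law №8 `Node00.IdxB8Laws.trunc_lt` iterated (`B8IdxB8LawsCoverZero.lamS_below_eq_top`): below the truncation level the families of the `m`-truncated
  tower ARE the top tower's, so the (1.5)-reading is asked of the TOP tower `i.Λs i.k` only and (L2) follows at EVERY truncation `m ≤ k` (§2).
So on an admissible member whose top tower reads (1.5) the class law holds with NO displayed geometric hypothesis (§2), and n06-b's binders `AvgAtP` ∕ `AvgAtγ`
at print's class are fed by name (§2).  §3 is A6: print's cube tower `({□_j}, cubeLamS)` of Sect. F (n05-c's member `B8CubeMemberIdxB8Laws.exists_member_cube_laws`)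
READS (1.5) at the top truncation (`cubeLamS … k j = cubeLam … j = □_j^{(j)} ∖ □_{j+1}^{(j)}` for `j < k`), is admissible (`cubeFam_domainSeq`) and obeys the laws —
the hypotheses of §2 are jointly inhabited at every depth `k ≥ 1`, and (L2) ∕ the class law hold there outright.

## WHAT IS PROVED (kernel, 0 sorry; theorems only, lattice bookkeeping)

* §1 `not_mem_succ_of_under` (core: `DomainSeq L Ω`, `Lʲ•z ∉ Ω (j+1)`, `Under L j z x` ⇒ `x ∉ Ω (j+1)`; `L ≥ 1`) · ★ `layer_of_lam` ((L2) at truncation `m` from the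
  (1.5)-reading of `Λs m` below `m`) · `layer_of_smul_not_mem` (the same from the bare clause `Lʲ•z ∉ Ω_{j+1}`) · ★★ `levelSepPP_towerBondsP_of_domainSeq_lam`
  (n05-w2's `levelSepPP_towerBondsP_of_domainSeq` with `hlay` discharged).
* §2 ★ `layer_member_of_lamTop` (`IdxB8Laws L i` + `DomainSeq L i.Ω` + (1.5)-reading of the TOP tower ⇒ `hlay` at every `m ≤ i.k`) ·
  `levelSepPP_towerBondsP_member_of_lamTop` · `levelSepPP_towerBondsP_trunc_of_lamTop` · `avgAtP_withQQP_towerBondsP_trunc_of_lamTop` ∕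
  `avgAtγ_withQQP_towerBondsP_trunc_of_lamTop` (n06-b's edition-P binders at print's class of the member's truncated towers, BY NAME, `hcolU` ∕ `hlay` gone).
* §3 A6: `smul_mem_Lam_cubeFam_false_iff` (`j < k`: `Lʲ•z ∈ Lam L {□_j} j ↔ z ∈ cubeLam … j`) · ★ `lamTop_cubeLamS` (the cube tower reads (1.5) at the top
  truncation) · ★ `exists_member_layerLaw` (n05-c's lawful cube member: `DomainSeq` + (1.5)-reading + laws, hence (L2) and the class law at every `m ≤ k`).

## HONEST SCOPE

Lattice geometry only; NO estimate of [Balaban1985RegularSpaces] ∕ [4] is proved or asserted.  The (1.5)-reading of the top tower is a DISPLAYED hypothesis on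
abstract members of n05-a's index (`ZdIdx` admits towers with extra, overlapping tops; (1.5) is not among its typed laws nor among `IdxB8Laws`) — it is print's own
definition of `Λ_j`, exhibited here on print's cube family `{□_j}` (`Ω₀ = □₀`); for the family `(T, □₁, …, □_k)` (`cubeFam true`, `Λ′₀ = T ∖ □₁`) the reading is
`B8Eq131CubesAdmissible.smul_mem_Lam_cubeFam_iff` BY NAME (not re-derived; its members' level-`0` tops are not exported field-wise by `exists_topCube_member_lawsB`,
so no member-level corollary is stated for it here).  The binders' further inputs and the sockets' satisfiability at `m ≥ 1` ([4] Thm 3.3, N06 content) are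
untouched; dag-n06-b g19's level-`0` edition `LevelSepPP0` is downstream of `LevelSepPP` by that seat's `levelSepPP0_of_levelSepPP` and is not restated.
Count-neutral; N05 ∕ N06 NOT discharged; no count claim (the chair's single count line is the only count); `T_η ↦ ℤᵈ`; one finite `𝕋⁴` programme at fixed `ε`,
Bałaban AS PRINTED; the Yang–Mills mass gap (Clay) is NOT proved by any of this — R4 closes the conditional finite-`𝕋⁴` rung `BalabanLadder.UV` only; nothing
continuum ∕ ℝ⁴ ∕ OS.  No `sorry`, no `def`, no `instance`, no `notation`.  Unit `pub-ymgap-dag-n05-w6` (g2), 2026-08-28.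

RELATED IN THE TREE, NOT DUPLICATED: `B8TowerBondsLevelSep` (n05-w2 g2: §1 law, §3 binders, §4 (L1) from `DomainSeq` — USED), `B8ConstraintBonds` (`DomainSeq`, `Lam`,
USED), `B8Eq131DomainSeq` (r05: the dictionary and `not_mem_succ_of_mem_Lam_smul` at a crossing bond — the bond-level cousin of §1), `B8IdxB8LawsCoverZero`
(`lamS_below_eq_top`, USED), `B8Eq191FlatLettersCubeMember` (`under_iff_blockMap_eq`, USED), `B7BlockGeometry` (`blockMap_blockMap`, USED), `B8Eq131CubesAdmissible`
(`cubeFam_domainSeq`, `smul_mem_cube(_succ)_iff`, `smul_mem_Lam_cubeFam_iff`, USED), `B8CubeMemberZd` ∕ `B8CubeMemberIdxB8Laws` (n05-c: the cube member and its laws,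
USED), `B8CubeMemberLevelSep` (n05-c: the class law at the cube member's SPLIT class `cubeLamBP'` directly — a different class map, not re-derived).

[cite: Balaban1985RegularSpaces, (1.3)–(1.6) p.77, (1.19) p.79, (1.31) p.82, (1.34) p.82, (1.68) p.88, (1.131) p.99, p.98; Balaban1984PropagatorsII, (2.1)–(2.3) p.224;
Balaban1985BackgroundPropagators, (3.16) p.393]
-/

noncomputable section

namespace Literature.MathematicalPhysics.QuantumFieldTheory.Balaban1983to89.B8TowerBondsLayerLawOfLam

open Literature.MathematicalPhysics.QuantumLattice (blockMap)
open B7Prop1Explicit B7Prop1Local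
open B7BlockGeometry (blockMap_blockMap)
open B8Ineq132 (Under BondTouches)
open B8LeafModelZd (ZdIdx)
open B8ConstraintBonds (DomainSeq Lam)
open B8Eq131DomainSeq (isLevel_pow_smul)
open B8Eq131CubesAdmissible (cubeFam cubeFam_false_of_le cubeFam_domainSeq smul_mem_cube_iff smul_mem_cube_succ_iff)
open B8CubeMemberZd (cubeLam cubeLamS cubeLamS_top)
open B8CubeMemberIdxB8Laws (exists_member_cube_laws)
open B8Eq191FlatLettersCubeMember (under_iff_blockMap_eq)
open B8IdxB8LawsCoverZero (lamS_below_eq_top)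
open B8TowerBondsPrinted (towerBondsP)
open B9Eq316AveragingTransposeZdPrinted (LevelSepPP)
open B8TowerBondsLevelSep (levelSepPP_towerBondsP levelSepPP_towerBondsP_trunc levelSepPP_towerBondsP_of_domainSeq unitCollar_of_domainSeq
  avgAtP_withQQP_towerBondsP_trunc avgAtγ_withQQP_towerBondsP_trunc)
open Node00 (IdxB8Laws)

-- `Site` alone could resolve to the torus sites of `Setup.lean`; re-export the `ℤ^d` sites of `B7Prop1Explicit`.
export B7Prop1Explicit (Site)

variable {d : ℕ}

/-! ## §1 The layer law (L2) from (1.5) as typed + the saturation of the admissibility record -/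

section Core

variable {L : ℕ}

/-- The corner `Lʲ•z` lies in its own `j`-block: `Under L j z (Lʲ•z)` (`L ≥ 1`; private plumbing). [folklore] -/
private theorem under_smul_self (hL : 1 ≤ L) (j : ℕ) (z : Site d) : Under L j z (((L : ℤ) ^ j) • z) := by
  intro i
  have h1 : (1 : ℤ) ≤ (L : ℤ) ^ j := one_le_pow₀ (by exact_mod_cast hL)
  simp only [Pi.smul_apply, smul_eq_mul]
  constructor
  · exact le_rfl
  · nlinarith

/-- **CORE STEP — a `j`-block whose corner is outside `Ω_{j+1}` avoids `Ω_{j+1}`**: under the admissibility record `DomainSeq L Ω` ((1.3)–(1.4) as typed; only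
`sat` «Ω_{j+1} = B^{j+1}(Ω_{j+1}^{(j+1)})» is used), if the fine corner `Lʲ•z` of the level-`j` top `z` is not in `Ω_{j+1}` then NO site `x` of the `j`-block of `z`
(`Under L j z x`) is in `Ω_{j+1}` — `x` and `Lʲ•z` lie in the same `Lʲ`-block (label `z`), hence in the same `L^{j+1}`-block (`⌊⌊·∕Lʲ⌋∕L⌋ = ⌊·∕L^{j+1}⌋`), and `Ω_{j+1}`
is saturated for `L^{j+1}`-blocks. (`L ≥ 1`.) [cite: Balaban1985RegularSpaces, (1.4) p.77 («Ω_j = Bʲ(Ω_j^{(j)})»), (1.5) p.77] -/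
theorem not_mem_succ_of_under (hL : 1 ≤ L) {Ω : ℕ → Set (Site d)} (hΩ : DomainSeq L Ω) {j : ℕ} {z x : Site d}
    (hz : ((L : ℤ) ^ j) • z ∉ Ω (j + 1)) (hx : Under L j z x) : x ∉ Ω (j + 1) := by
  intro hxΩ
  have h1 : blockMap (L ^ j) x = z := (under_iff_blockMap_eq hL j z x).mp hx
  have h2 : blockMap (L ^ j) (((L : ℤ) ^ j) • z) = z := (under_iff_blockMap_eq hL j z _).mp (under_smul_self hL j z)
  have h12 : blockMap (L ^ (j + 1)) x = blockMap (L ^ (j + 1)) (((L : ℤ) ^ j) • z) := by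
    rw [pow_succ, ← blockMap_blockMap, ← blockMap_blockMap, h1, h2]
  exact hz (hΩ.sat (j + 1) x _ h12 hxΩ)

/-- (L2) at truncation `m` from the bare clause «the corner `Lʲ•z` of every top `z ∈ Λs m j`, `j < m`, lies outside `Ω_{j+1}`» (the `∉ Ω_{j+1}` half of (1.5)) and the
admissibility record. [cite: Balaban1985RegularSpaces, (1.5) p.77, (1.4) p.77] -/
theorem layer_of_smul_not_mem (hL : 1 ≤ L) {Ω : ℕ → Set (Site d)} (hΩ : DomainSeq L Ω) {Λs : ℕ → ℕ → Set (Site d)} {m : ℕ}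
    (hΛ : ∀ j, j < m → ∀ z ∈ Λs m j, ((L : ℤ) ^ j) • z ∉ Ω (j + 1)) :
    ∀ j, j < m → ∀ z ∈ Λs m j, ∀ x, Under L j z x → x ∉ Ω (j + 1) :=
  fun j hj z hz _ hx => not_mem_succ_of_under hL hΩ (hΛ j hj z hz) hx

/-- ★ **THE LAYER LAW (L2) FROM PRINT'S (1.5) AS TYPED**: for an admissible domain sequence (`DomainSeq L Ω`, `L ≥ 1`) and a family of tower tops whose levels below the
truncation `m` READ print's (1.5) — «`z ∈ Λs m j`, `j < m` ⇒ `Lʲ•z ∈ Λ_j = Ω_j^{(j)} ∖ Ω_{j+1}^{(j)}`» (`B8ConstraintBonds.Lam`; r05's dictionary shape of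
`B8Eq131DomainSeq` §3) — every site of the `j`-block of such a top lies outside `Ω_{j+1}`: the hypothesis `hlay` of `B8TowerBondsLevelSep.levelSepPP_towerBondsP`.
[cite: Balaban1985RegularSpaces, (1.5) p.77 («Λ_j = Ω_j^{(j)} ∖ Ω_{j+1}^{(j)}»), (1.4) p.77, (1.6) p.77 («Ω = ⋃_j Bʲ(Λ_j)»)] -/
theorem layer_of_lam (hL : 1 ≤ L) {Ω : ℕ → Set (Site d)} (hΩ : DomainSeq L Ω) {Λs : ℕ → ℕ → Set (Site d)} {m : ℕ}
    (hΛ : ∀ j, j < m → ∀ z ∈ Λs m j, ((L : ℤ) ^ j) • z ∈ Lam L Ω j) :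
    ∀ j, j < m → ∀ z ∈ Λs m j, ∀ x, Under L j z x → x ∉ Ω (j + 1) :=
  layer_of_smul_not_mem hL hΩ (fun j hj z hz => (hΛ j hj z hz).2.2)

/-- ★★ **THE CLASS LAW AT PRINT'S CLASS OF AN ADMISSIBLE Λ-TOWER READING (1.5), NO DISPLAYED GEOMETRY LEFT**: `DomainSeq L Ω` ((1.3)–(1.4), typed) + the
(1.5)-reading of the tops below the truncation `m` ⇒ `LevelSepPP L m Ω (fun m' j => towerBondsP L Ω (Λs m') j) 1` — n05-w2's `levelSepPP_towerBondsP_of_domainSeq`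
(whose (L1) came from `DomainSeq` already) with its last displayed hypothesis (L2) discharged by `layer_of_lam`.
[cite: Balaban1985RegularSpaces, (1.3)–(1.5) p.77, (1.31) p.82; Balaban1984PropagatorsII, (2.1)–(2.3) p.224; Balaban1985BackgroundPropagators, (3.16) p.393] -/
theorem levelSepPP_towerBondsP_of_domainSeq_lam (hL : 1 ≤ L) {Ω : ℕ → Set (Site d)} (hΩ : DomainSeq L Ω) (Λs : ℕ → ℕ → Set (Site d)) {m : ℕ}
    (hΛ : ∀ j, j < m → ∀ z ∈ Λs m j, ((L : ℤ) ^ j) • z ∈ Lam L Ω j) :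
    LevelSepPP L m Ω (fun m' j => towerBondsP L Ω (Λs m') j) 1 :=
  levelSepPP_towerBondsP_of_domainSeq hL hΩ Λs (layer_of_lam hL hΩ hΛ)

end Core

/-! ## §2 Member forms: the (1.5)-reading is asked of the TOP tower only (law №8 `trunc_lt`); n06-b's binders by name -/

section Member

variable {L : ℕ}

/-- ★ **(L2) AT EVERY TRUNCATION OF A LAWFUL ADMISSIBLE MEMBER WHOSE TOP TOWER READS (1.5)**: for `i : ZdIdx d L` with the located laws `IdxB8Laws L i` (only №8
`trunc_lt` is used: `Λs m j = Λs k j` for `j < m ≤ k`, `B8IdxB8LawsCoverZero.lamS_below_eq_top`), an admissible tower `DomainSeq L i.Ω`, and the (1.5)-reading of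
the TOP families «`z ∈ i.Λs i.k j`, `j < k` ⇒ `Lʲ•z ∈ Λ_j`», the layer law `hlay` of `B8TowerBondsLevelSep` holds at every truncation `m ≤ i.k`. (`L ≥ 1`.)
[cite: Balaban1985RegularSpaces, (1.5) p.77, (1.19) p.79, (1.34) p.82 (truncated towers agree below the top), (1.4) p.77] -/
theorem layer_member_of_lamTop (hL : 1 ≤ L) (i : ZdIdx d L) (hlaws : IdxB8Laws L i) (hΩ : DomainSeq L i.Ω)
    (hΛ : ∀ j, j < i.k → ∀ z ∈ i.Λs i.k j, ((L : ℤ) ^ j) • z ∈ Lam L i.Ω j) :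
    ∀ m, m ≤ i.k → ∀ j, j < m → ∀ z ∈ i.Λs m j, ∀ x, Under L j z x → x ∉ i.Ω (j + 1) := by
  intro m hm j hj z hz x hx
  rw [lamS_below_eq_top hlaws hj hm] at hz
  exact not_mem_succ_of_under hL hΩ (hΛ j (lt_of_lt_of_le hj hm) z hz).2.2 hx

/-- **The class law at every truncation `m ≤ k` of such a member**, for the member-wise class map `fun m j => towerBondsP L i.Ω (i.Λs m) j` — n05-w2's
`levelSepPP_towerBondsP_member` with (L1) from `DomainSeq` (`unitCollar_of_domainSeq`) and (L2) from (1.5) (`layer_member_of_lamTop`).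
[cite: Balaban1985RegularSpaces, (1.31) p.82, (1.3)–(1.5) p.77; Balaban1984PropagatorsII, (2.3) p.224] -/
theorem levelSepPP_towerBondsP_member_of_lamTop (hL : 1 ≤ L) (i : ZdIdx d L) (hlaws : IdxB8Laws L i) (hΩ : DomainSeq L i.Ω)
    (hΛ : ∀ j, j < i.k → ∀ z ∈ i.Λs i.k j, ((L : ℤ) ^ j) • z ∈ Lam L i.Ω j) :
    ∀ m, m ≤ i.k → LevelSepPP L m i.Ω (fun m' j => towerBondsP L i.Ω (i.Λs m') j) 1 :=
  fun m hm => levelSepPP_towerBondsP hL i.hΩ i.Λs (unitCollar_of_domainSeq hL hΩ) (layer_member_of_lamTop hL i hlaws hΩ hΛ m hm)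

/-- **The class law at EVERY truncation `m` through the TRUNCATED class map** `fun m' j => if m' ≤ k then towerBondsP … else ∅` (dag-n06-b's junk-level recipe;
vacuous above `k`) — n05-w2's `levelSepPP_towerBondsP_trunc` with both displayed laws discharged (`DomainSeq` + (1.5)-reading of the top tower).
[cite: Balaban1985RegularSpaces, (1.31) p.82, (1.68) p.88, (1.3)–(1.5) p.77; Balaban1984PropagatorsII, (2.3) p.224] -/
theorem levelSepPP_towerBondsP_trunc_of_lamTop (hL : 1 ≤ L) (i : ZdIdx d L) (hlaws : IdxB8Laws L i) (hΩ : DomainSeq L i.Ω)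
    (hΛ : ∀ j, j < i.k → ∀ z ∈ i.Λs i.k j, ((L : ℤ) ^ j) • z ∈ Lam L i.Ω j) (m : ℕ) :
    LevelSepPP L m i.Ω (fun m' j => if m' ≤ i.k then towerBondsP L i.Ω (i.Λs m') j else ∅) 1 :=
  levelSepPP_towerBondsP_trunc hL i (unitCollar_of_domainSeq hL hΩ) (layer_member_of_lamTop hL i hlaws hΩ hΛ) m

variable {𝔸 : Type*} [CStarAlgebra 𝔸] (τ : 𝔸 →ₗ[ℂ] ℂ) [FiniteDimensional ℝ 𝔸] [Nontrivial 𝔸]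

open B9SupplySockB9P3ZdLetters (OpsZd)
open B9SupplySockB9P3ZdGammaUniv (AvgAtP)
open B9SupplySockB9P3ZdGamma (AvgAtγ)
open B9Eq316AveragingTransposeZd (qQ betaTau)
open B9Eq316AveragingTransposeZdPrinted (withQQP)

/-- ★ **THE GENUINE AVERAGING LETTER'S `AvgAtP` BINDER AT PRINT'S CLASS OF THE MEMBER'S TRUNCATED TOWERS, every truncation `m`, NO displayed index law**
(`d, L ≥ 2`): n05-w2's `avgAtP_withQQP_towerBondsP_trunc` (= dag-n06-b's `avgAtP_withQQP` ∘ the class law) with `hcolU` from `DomainSeq` and `hlay` from the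
(1.5)-reading of the top tower — constant `qQ d L C_τ β_τ 1`.
[cite: Balaban1985BackgroundPropagators, (3.16) p.393; Balaban1985RegularSpaces, (1.56), (1.58) p.86, (1.31) p.82, (1.3)–(1.5) p.77, (1.68) p.88] -/
theorem avgAtP_withQQP_towerBondsP_trunc_of_lamTop (hd : 2 ≤ d) (hL : 2 ≤ L)
    {Cτ : ℝ} (hCτ : ∀ x y : 𝔸, |(τ (star x * y)).re| ≤ Cτ * ‖x‖ * ‖y‖)
    (ops₀ : ℝ → ZdIdx d L → ℕ → OpsZd d 𝔸) (M : ℝ) (i : ZdIdx d L) (hlaws : IdxB8Laws L i) (hΩ : DomainSeq L i.Ω)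
    (hΛ : ∀ j, j < i.k → ∀ z ∈ i.Λs i.k j, ((L : ℤ) ^ j) • z ∈ Lam L i.Ω j) (m : ℕ) :
    AvgAtP L (withQQP τ L (fun m' j => if m' ≤ i.k then towerBondsP L i.Ω (i.Λs m') j else ∅) ops₀) (qQ d L Cτ (betaTau τ) 1)
      (fun m' j => if m' ≤ i.k then towerBondsP L i.Ω (i.Λs m') j else ∅) M i m :=
  have hL1 : 1 ≤ L := le_trans one_le_two hL
  avgAtP_withQQP_towerBondsP_trunc τ hd hL hCτ ops₀ M i (unitCollar_of_domainSeq hL1 hΩ) (layer_member_of_lamTop hL1 i hlaws hΩ hΛ) m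

/-- ★ **The same in the γ currency** (`AvgAtγ`, the binder of the γ suppliers `sockB9P3D4γ(I)_at`), every truncation `m`, NO displayed index law: n05-w2's
`avgAtγ_withQQP_towerBondsP_trunc` with `hcolU` ∕ `hlay` discharged as above.
[cite: Balaban1985BackgroundPropagators, (3.16) p.393; Balaban1985RegularSpaces, (1.56), (1.58) p.86, (1.31) p.82, (1.3)–(1.5) p.77, (1.68) p.88] -/
theorem avgAtγ_withQQP_towerBondsP_trunc_of_lamTop (hd : 2 ≤ d) (hL : 2 ≤ L)
    {Cτ : ℝ} (hCτ : ∀ x y : 𝔸, |(τ (star x * y)).re| ≤ Cτ * ‖x‖ * ‖y‖)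
    (ops₀ : ℝ → ZdIdx d L → ℕ → OpsZd d 𝔸) (M : ℝ) (i : ZdIdx d L) (hlaws : IdxB8Laws L i) (hΩ : DomainSeq L i.Ω)
    (hΛ : ∀ j, j < i.k → ∀ z ∈ i.Λs i.k j, ((L : ℤ) ^ j) • z ∈ Lam L i.Ω j) (m : ℕ) :
    AvgAtγ L (withQQP τ L (fun m' j => if m' ≤ i.k then towerBondsP L i.Ω (i.Λs m') j else ∅) ops₀) (qQ d L Cτ (betaTau τ) 1)
      (fun m' j => if m' ≤ i.k then towerBondsP L i.Ω (i.Λs m') j else ∅) M i m :=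
  have hL1 : 1 ≤ L := le_trans one_le_two hL
  avgAtγ_withQQP_towerBondsP_trunc τ hd hL hCτ ops₀ M i (unitCollar_of_domainSeq hL1 hΩ) (layer_member_of_lamTop hL1 i hlaws hΩ hΛ) m

end Member

/-! ## §3 A6: print's cube family `{□_j}` with its truncated towers `cubeLamS` READS (1.5) — the hypotheses of §2 are jointly inhabited at every depth -/

section Witness

variable {L : ℕ}

/-- **(1.5) at the cube family `{□_j}_{j=0}^{k}` (`Ω₀ = □₀`), below the top**: for `j < k` a level-`j` site `z` has its fine corner `Lʲ•z` in
`Λ_j = Ω_j^{(j)} ∖ Ω_{j+1}^{(j)}` of the typed record iff `z ∈ cubeLam … j = □_j^{(j)} ∖ □_{j+1}^{(j)}` (n05-c's restriction set; `Lʲ•z ∈ □_j ⇔ z ∈ □_j^{(j)}`,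
`Lʲ•z ∈ □_{j+1} ⇔ z ∈ □_{j+1}^{(j)}` by `B8Eq131CubesAdmissible.smul_mem_cube(_succ)_iff`).  (The `(T, □₁, …, □_k)` twin with `Λ′₀ = T ∖ □₁` is
`B8Eq131CubesAdmissible.smul_mem_Lam_cubeFam_iff`.) [cite: Balaban1985RegularSpaces, (1.5) p.77, (1.131) p.99 («Λ′_j = □_j^{(j)} ∖ □_{j+1}^{(j)}»), p.98] -/
theorem smul_mem_Lam_cubeFam_false_iff (hL : 1 ≤ L) (a : Site d) (M ρ : ℕ) {k j : ℕ} (hj : j < k) (z : Site d) :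
    ((L : ℤ) ^ j) • z ∈ Lam L (cubeFam false L a M ρ k) j ↔ z ∈ cubeLam L a M ρ k j := by
  simp only [Lam, cubeLam, Set.mem_setOf_eq, cubeFam_false_of_le L a M ρ hj.le, cubeFam_false_of_le L a M ρ (Nat.succ_le_of_lt hj),
    smul_mem_cube_iff hL, smul_mem_cube_succ_iff hL a M ρ hj]
  exact ⟨fun h => ⟨h.2.1, fun _ => h.2.2⟩, fun h => ⟨isLevel_pow_smul L j z, h.1, h.2 hj⟩⟩

/-- ★ **PRINT'S CUBE TOWER READS (1.5) AT THE TOP TRUNCATION**: for every `j < k`, every top `z` of the un-truncated family `cubeLamS … k j` (= `cubeLam … j`,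
`B8CubeMemberZd.cubeLamS_top`) has `Lʲ•z ∈ Λ_j` of the record `{□_j}` — the hypothesis `hΛ` of §2 at n05-c's cube member.
[cite: Balaban1985RegularSpaces, (1.5) p.77, (1.68) p.88, (1.131) p.99, p.98] -/
theorem lamTop_cubeLamS (hL : 1 ≤ L) (a : Site d) (M ρ k : ℕ) :
    ∀ j, j < k → ∀ z ∈ cubeLamS L a M ρ k k j, ((L : ℤ) ^ j) • z ∈ Lam L (cubeFam false L a M ρ k) j := by
  intro j hj z hz
  rw [cubeLamS_top L a M ρ hj.le] at hz
  exact (smul_mem_Lam_cubeFam_false_iff hL a M ρ hj z).mpr hz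

/-- ★ **A6 — THE HYPOTHESES OF §2 ARE JOINTLY INHABITED AT EVERY DEPTH, BY PRINT'S OWN CUBE MEMBER**: for `1 ≤ L ≤ ρ`, `k ≥ 1` and a spacing `η > 0` with `Lᵏη ≤ 1`,
n05-c's concrete member of n05-a's index (`B8CubeMemberIdxB8Laws.exists_member_cube_laws`: `Ω = {□_j}`, `Λs = cubeLamS`, the three located laws `IdxB8Laws`) is an
ADMISSIBLE domain sequence (`cubeFam_domainSeq`), its top tower READS (1.5) (`lamTop_cubeLamS`), and therefore — by §2, not by hypothesis — the layer law (L2) holds at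
every truncation `m ≤ k` and so does the averaging-binder class law `LevelSepPP L m Ω (fun m' j => towerBondsP L Ω (Λs m') j) 1`.
[cite: Balaban1985RegularSpaces, (1.3)–(1.6) p.77, (1.31) p.82, (1.68) p.88, (1.131)–(1.132) p.99, p.98 («The sequence of cubes {□_j} is an admissible family»);
Balaban1984PropagatorsII, (2.1)–(2.3) p.224] -/
theorem exists_member_layerLaw (hL : 1 ≤ L) (a : Site d) (M : ℕ) {ρ : ℕ} (hρ : L ≤ ρ) {k : ℕ} (hk : 1 ≤ k) {η : ℝ}
    (hη : 0 < η) (hscale : (L : ℝ) ^ k * η ≤ 1) :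
    ∃ i : ZdIdx d L, i.k = k ∧ i.η = η ∧ i.Ω = cubeFam false L a M ρ k ∧ i.Λs = cubeLamS L a M ρ k ∧ IdxB8Laws L i ∧ DomainSeq L i.Ω ∧
      (∀ j, j < i.k → ∀ z ∈ i.Λs i.k j, ((L : ℤ) ^ j) • z ∈ Lam L i.Ω j) ∧
      (∀ m, m ≤ i.k → ∀ j, j < m → ∀ z ∈ i.Λs m j, ∀ x, Under L j z x → x ∉ i.Ω (j + 1)) ∧
      ∀ m, m ≤ i.k → LevelSepPP L m i.Ω (fun m' j => towerBondsP L i.Ω (i.Λs m') j) 1 := by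
  obtain ⟨i, hik, hiη, hΩ, hΛ, -, hlaws⟩ := exists_member_cube_laws hL a M hρ hk hη hscale
  have hds : DomainSeq L i.Ω := by
    rw [hΩ]
    exact cubeFam_domainSeq false hL a M hρ k
  have hlam : ∀ j, j < i.k → ∀ z ∈ i.Λs i.k j, ((L : ℤ) ^ j) • z ∈ Lam L i.Ω j := by
    intro j hj z hz
    rw [hik] at hj
    rw [hΛ, hik] at hz
    rw [hΩ]
    exact lamTop_cubeLamS hL a M ρ k j hj z hz
  exact ⟨i, hik, hiη, hΩ, hΛ, hlaws, hds, hlam, layer_member_of_lamTop hL i hlaws hds hlam,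
    levelSepPP_towerBondsP_member_of_lamTop hL i hlaws hds hlam⟩

end Witness

end Literature.MathematicalPhysics.QuantumFieldTheory.Balaban1983to89.B8TowerBondsLayerLawOfLam

end
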